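import Summits.CriticalPhenomena.PercolationContinuityZ3.Theorems.PercNearOneGluingNoHeavyLowerTailFKHullPortRigid
import Literature.Probability.LatticeModels.FKInterfacePairing
import HarnessLib

/-!
# FK sub-lane: Lemma `Δ_N` for `φ_{𝐩,q}` from prim-hp-7's Lemma `P_v` (the single-pair case: constant tilt + factorisation)

Support file (`--supports stmt-CriticalPhenomena-4575`), FK sub-lane `prim-bschramm-fk-2` (gen 3); builds on p205010 (kernel theorem,
internal audit signed; external expert review pending).  No definitions, no named facts, no sorries; standard axioms.

Part 4 (the single-pair case and the assembled theorem) of the Lean proof of THE LOCATED OPEN LEMMA OF THE FK FINITE LEG (lane VERDICT V40: "(Δ) = Lemma Δ_N for FK: Cov_{φ(·|C_y ∌ s,x)}(Ψ_{s,y,U}(C_x), ω_e) ≤ 0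
for e = xv at x"), in the sum-level vocabulary of `…FKHullPortTADefs.lean` and for an avoided vertex SET `X` (bschramm/FK-Q2.md §12):
for `q ≥ 1`, a weight vector `w` whose weight-`1` pairs lie inside `X` (they encode earlier contractions), and a pair `e = s(a,b)`
touching `X` (`a ∈ X`) with `0 < w e < 1`,
  `B(w[e↦1], X∪{b}) · b(w[e↦0], X) ≤ B(w[e↦0], X) · b(w[e↦1], X∪{b})`,
where `(w[e↦1], X∪{b})` is the honest contraction `G/e` and `(w[e↦0], X)` the deletion `G∖e`; i.e. contracting an edge at the avoided
set lowers `E[Ψ(C_X) | C_y ∌ s, C_y ∩ X = ∅]`.  The q = 1 proof (prim-hp-7 HP7-MDLX-PROOF §4, prove-5 `HullPort.deltaN_nonneg`) couples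
`K₁ = K₀ ∪ C_v` on ONE product measure; for `q > 1` that coupling leaves a cross-measure term (FK-Q2 §11.3 (IIa)).  The FK proof uses NO
coupling: a SECOND one-edge Bernstein deformation at another fractional pair `f` touching `X` makes the claim a quadratic in `w f` whose
endpoint coefficients and whose `B·b` cross factor are instances of the claim at smaller states, and whose other cross factor is the positive
correlation of `ω_e, ω_f` given avoidance (van den Berg–Häggström–Kahn Thm 2.1 for `φ_{𝐩,q}`); the single-fractional-pair case is prim-hp-7's
Lemma `P_v` for `φ_{𝐩,q}` after a Markov factorisation (vdBHK Lemma 2.3) and a constant tilt `q⁻¹`.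

THIS FILE: `FK.sum_update_one_eq_tilt` (contracting the unique exit of `X` always merges two clusters: `Σ w_q[e↦1] F = q⁻¹ Σ w_q[e↦0] F(· ∪ e)`),
`FK.deltaN_single_of_Pv` (the hypothesis `hBase` of `FK.deltaN_nonneg_of_single` from `hPv` = Lemma `P_v` for `φ_{𝐩,q}` in sum form for
every weighted graph: internal pair ⇒ `Δ = 0`; exit ⇒ `P_v` in the world `H` at `v = b`), and the assembled
**`FK.deltaN_nonneg_of_Pv`** — Lemma `Δ_N` for `φ_{𝐩,q}`, every `q ≥ 1`, modulo `hPv` only (the FK analogue of prove-5's `HullPort.deltaN_nonneg`).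
[cite: VandenbergHaggstromKahn2005, Thm. 2.1 (p. 9); §1 pp. 3–5; §2.1 Lemmas 2.2–2.3 (p. 10)]
[cite: Grimmett2006, §1.4 eq. (1.20) (p. 15); Thm. (3.1)(a) (p. 37); Thm. (3.8)(b)]
-/

noncomputable section

namespace Summit.CriticalPhenomena.PercolationContinuityZ3.Theorems.FK

open MeasureTheory Set Literature.Probability.LatticeModels Literature.Probability.Percolation
open Literature.Probability.Percolation.DecisionTree (ind ind_of_mem ind_of_not_mem ind_nonneg)
open Literature.Probability.Percolation.BHK2006 (rcMass delW)
open Summit.CriticalPhenomena.PercolationContinuityZ3.Theorems.HullPort (cut avoidEv)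
open scoped Classical

variable {V : Type*} [Fintype V]

section SinglePair

open Literature.Probability.Percolation.BHK2006 (weight rcMass_nonneg coe_delW setCl barOf mem_setCl_iff mem_barOf_iff
  rc_sum_setCl_eq sum_rcMass)
open Summit.CriticalPhenomena.PercolationContinuityZ3.Theorems.HullPort (insert_mem_avoidEv_iff cut_insert_edge edge_mem_cut
  eq_of_reachable_of_isolated mem_cut_of_mem cut_insert_vertex cut_empty mem_of_reachable_of_noBoundary
  not_mem_of_reachable_of_noBoundary cut_eq_of_noBoundary reachable_sdiff_iff_of_noBoundary sum_weight_resample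
  avoidEv_insert_insert_eq ind_inter_compl)

/-! ### The constant tilt: contraction versus deletion of the unique exit -/

/-- **Constant tilt.** If `e = s(a,b)` (`a ∈ X`, `b ∉ X`) is the only fractional pair touching `X` (weight-`1` pairs inside `X`),
then `Σ_ω w_q[e↦1](ω) F(ω) = q⁻¹ · Σ_ω w_q[e↦0](ω) F(ω ∪ {e})`: contracting `e` always merges two distinct clusters.
[cite: Grimmett2006, §1.2 (edge insertion), Thm. (3.1)(a)] -/
theorem sum_update_one_eq_tilt (w : Sym2 V → unitInterval) {q : ℝ} (hq : 0 < q) {X : Set V} {a b : V} (haX : a ∈ X)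
    (hbX : b ∉ X)
    (hR0 : ∀ p : Sym2 V, ¬ p.IsDiag → (∃ u ∈ p, u ∈ X) → p ≠ s(a, b) →
      ((w p : unitInterval) : ℝ) = 0 ∨ ((w p : unitInterval) : ℝ) = 1)
    (hINV : ∀ p : Sym2 V, ((w p : unitInterval) : ℝ) = 1 → ∀ u ∈ p, u ∈ X) (F : Set (Sym2 V) → ℝ) :
    ∑ ω, rcWeightW (Function.update w s(a, b) 1) q ∅ ω * F ω =
      q⁻¹ * ∑ ω, rcWeightW (Function.update w s(a, b) 0) q ∅ ω * F (insert s(a, b) ω) := by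
  classical
  set e : Sym2 V := s(a, b) with he
  set w₁ := Function.update w e 1 with hw₁
  set w₀ := Function.update w e 0 with hw₀
  have hab : a ≠ b := fun h => hbX (h ▸ haX)
  -- resample the coordinate `e` in the product part
  have key := sum_weight_resample (fun p => ((w₁ p : unitInterval) : ℝ)) (fun p => ((w₀ p : unitInterval) : ℝ)) e
    (by simp [hw₀]) (fun p hp => by simp [hw₀, hw₁, Function.update_of_ne hp])
    (fun η => q ^ clusterCount η (∅ : Set V) * F η)
  have h1e : ((w₁ e : unitInterval) : ℝ) = 1 := by simp [hw₁]
  simp only [h1e, sub_self, zero_mul, zero_add, one_mul] at key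
  have lhs : ∑ ω, rcWeightW w₁ q ∅ ω * F ω = ∑ η, weight (fun p => ((w₁ p : unitInterval) : ℝ)) η * (q ^ clusterCount η (∅ : Set V) * F η) := by
    refine Finset.sum_congr rfl fun η _ => ?_
    unfold rcWeightW; ring
  rw [lhs, key, Finset.mul_sum]
  refine Finset.sum_congr rfl fun η _ => ?_
  by_cases hz : weight (fun p => ((w₀ p : unitInterval) : ℝ)) η = 0
  · unfold rcWeightW; rw [hz]; ring
  · -- nonzero product weight: `e ∉ η`, and `η` has no open boundary pair of `X`, so `a ≁ b`
    have hfac : ∀ p : Sym2 V, (if p ∈ η then ((w₀ p : unitInterval) : ℝ) else 1 - ((w₀ p : unitInterval) : ℝ)) ≠ 0 := by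
      intro p
      have := Finset.prod_ne_zero_iff.1 hz p (Finset.mem_univ p)
      exact this
    have hne : rcWeightW w₀ q ∅ η ≠ 0 := mul_ne_zero hz (pow_ne_zero _ hq.ne')
    have hR : ∀ p : Sym2 V, ¬ p.IsDiag → (∃ u ∈ p, u ∈ X) → ((w₀ p : unitInterval) : ℝ) = 0 ∨ ((w₀ p : unitInterval) : ℝ) = 1 := by
      intro p hd hp
      by_cases hpe : p = e
      · left; rw [hpe]; simp [hw₀]
      · rw [show w₀ p = w p from Function.update_of_ne hpe _ _]; exact hR0 p hd hp hpe
    have hINV0 : ∀ p : Sym2 V, ((w₀ p : unitInterval) : ℝ) = 1 → ∀ u ∈ p, u ∈ X := by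
      intro p hp u hu
      by_cases hpe : p = e
      · rw [hpe] at hp; simp [hw₀] at hp
      · rw [show w₀ p = w p from Function.update_of_ne hpe _ _] at hp; exact hINV p hp u hu
    have hζ := noBoundary_of_ne_zero (q := q) hR hINV0 hne
    have hnr : ¬ (openGraph η).Reachable a b := fun h => hbX (mem_of_reachable_of_noBoundary hζ haX h)
    have hcc : clusterCount (insert e η) (∅ : Set V) + 1 = clusterCount η (∅ : Set V) := by
      have h := clusterCount_insert η.toFinset a b (∅ : Set V)
      simp only [Finset.coe_insert, Set.coe_toFinset, wired_empty, sup_bot_eq] at h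
      rw [if_neg hnr] at h
      rw [he]; exact h
    have hpow : q ^ clusterCount (insert e η) (∅ : Set V) = q⁻¹ * q ^ clusterCount η (∅ : Set V) := by
      rw [← hcc, pow_succ]; field_simp
    unfold rcWeightW
    rw [hpow]; ring

/-- `φ_H(s ↮ y) > 0` for a weight vector with no weight-`1` pair (the empty configuration isolates `y`).
[cite: Grimmett2006, Thm. (3.1) eq. (3.4) (finite energy)] -/
theorem wE_compl_openConn_pos (u : Sym2 V → unitInterval) {q : ℝ} (hq : 0 < q) {s y : V} (hsy : s ≠ y)
    (hu : ∀ p : Sym2 V, ((u p : unitInterval) : ℝ) ≠ 1) : 0 < wE u q ∅ (ind (openConn s y : Set (BondConfig V))ᶜ) := by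
  classical
  unfold wE
  have hterm : ∀ η, 0 ≤ rcMass (delW u ∅) q η * ind (openConn s y : Set (BondConfig V))ᶜ η := fun η =>
    mul_nonneg (rcMass_nonneg _ hq η) (ind_nonneg _ _)
  refine lt_of_lt_of_le ?_ (Finset.single_le_sum (fun η _ => hterm η) (Finset.mem_univ (∅ : BondConfig V)))
  have hmem : (∅ : BondConfig V) ∈ (openConn s y : Set (BondConfig V))ᶜ := fun h =>
    hsy.symm (eq_of_reachable_of_isolated (fun e he => (Set.notMem_empty e he).elim) y h)
  rw [ind_of_mem hmem, mul_one, delW_empty]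
  unfold rcMass
  refine div_pos ?_ (rcPartitionFunctionW_pos u hq ∅)
  unfold rcWeightW weight
  refine mul_pos (Finset.prod_pos fun e _ => ?_) (pow_pos hq _)
  rw [if_neg (Set.notMem_empty e)]
  exact sub_pos.2 (lt_of_le_of_ne (u e).2.2 (hu e))

/-! ### The single-pair case -/

/-- **The single-fractional-pair case of Lemma `Δ_N` for `φ_{𝐩,q}`** (hypothesis `hBase` of `FK.deltaN_nonneg_of_single`) from
prim-hp-7's Lemma `P_v` for `φ_{𝐩,q}` in every weighted graph (hypothesis `hPv`, the FK form of prove-5's `hPv`):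
if `e = s(a,b)` is the only fractional pair touching `X`, then for an internal `e` both states are rigid and `Δ = 0`, and for an exit
`e` the contraction is `q⁻¹ ×` the state `(w[e↦0], X ∪ {b})` (constant tilt), the Markov factorisation (vdBHK Lemma 2.3) turns
everything into world quantities of `H = G − B_X`, and the inequality is exactly `P_v` in `H` with `v = b` (bschramm/FK-Q2.md §12.2 CASE B).
[cite: VandenbergHaggstromKahn2005, §2.1 Lemma 2.3 (p. 10); Thm. 1.3 (p. 6)] [cite: Gladkov2024, Thm. 3.2 (p. 4)]
[cite: Grimmett2006, Thm. (3.1)(a), eq. (1.20)] -/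
theorem deltaN_single_of_Pv {q : ℝ} (hq : 1 ≤ q) (s y : V) (hsy : s ≠ y) (g : Set (Sym2 V) → ℝ)
    (hPv : ∀ (u : Sym2 V → unitInterval) (v' : V),
      taB u q s y {v'} g ≤ rcPartitionFunctionW u q ∅ *
        ((1 - wE u q ∅ (ind ((openConn s y : Set (BondConfig V))ᶜ ∩ openConn y v')) /
              wE u q ∅ (ind (openConn s y : Set (BondConfig V))ᶜ)) *
          (wE u q ∅ (fun η => g (openEdgeCluster η s) * ind (openConn s y) η) -
            wE u q ∅ (fun η => g (openEdgeCluster η s)) * wE u q ∅ (ind (openConn s y)))))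
    (w : Sym2 V → unitInterval) (X : Set V) (hINV : ∀ p : Sym2 V, ((w p : unitInterval) : ℝ) = 1 → ∀ u ∈ p, u ∈ X)
    (hsX : s ∉ X) (hyX : y ∉ X) (a b : V) (ha : a ∈ X) (hab : a ≠ b) (hbs : b ≠ s) (hby : b ≠ y)
    (h0 : 0 < ((w s(a, b) : unitInterval) : ℝ)) (h1 : ((w s(a, b) : unitInterval) : ℝ) < 1)
    (hrig : ∀ p : Sym2 V, ¬ p.IsDiag → (∃ c ∈ p, c ∈ X) → p ≠ s(a, b) →
      ((w p : unitInterval) : ℝ) = 0 ∨ ((w p : unitInterval) : ℝ) = 1) :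
    0 ≤ taB (Function.update w s(a, b) 0) q s y X g * tab (Function.update w s(a, b) 1) q s y (insert b X) -
        taB (Function.update w s(a, b) 1) q s y (insert b X) g * tab (Function.update w s(a, b) 0) q s y X := by
  classical
  have hq0 : 0 < q := one_pos.trans_le hq
  set e : Sym2 V := s(a, b) with he
  set w₀ := Function.update w e 0 with hw₀
  set w₁ := Function.update w e 1 with hw₁
  -- rigidity and invariants of the deleted state
  have hR0 : ∀ p : Sym2 V, ¬ p.IsDiag → (∃ u ∈ p, u ∈ X) →
      ((w₀ p : unitInterval) : ℝ) = 0 ∨ ((w₀ p : unitInterval) : ℝ) = 1 := by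
    intro p hd hp
    by_cases hpe : p = e
    · left; rw [hpe]; simp [hw₀]
    · rw [show w₀ p = w p from Function.update_of_ne hpe _ _]; exact hrig p hd hp hpe
  have hI0 : ∀ p : Sym2 V, ((w₀ p : unitInterval) : ℝ) = 1 → ∀ u ∈ p, u ∈ X := by
    intro p hp u hu
    by_cases hpe : p = e
    · rw [hpe] at hp; simp [hw₀] at hp
    · rw [show w₀ p = w p from Function.update_of_ne hpe _ _] at hp; exact hINV p hp u hu
  by_cases hbX : b ∈ X
  · -- INTERNAL pair: both states are rigid, `Δ = 0`
    have hXb : insert b X = X := Set.insert_eq_of_mem hbX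
    have hR1 : ∀ p : Sym2 V, ¬ p.IsDiag → (∃ u ∈ p, u ∈ X) →
        ((w₁ p : unitInterval) : ℝ) = 0 ∨ ((w₁ p : unitInterval) : ℝ) = 1 := by
      intro p hd hp
      by_cases hpe : p = e
      · right; rw [hpe]; simp [hw₁]
      · rw [show w₁ p = w p from Function.update_of_ne hpe _ _]; exact hrig p hd hp hpe
    have hI1 : ∀ p : Sym2 V, ((w₁ p : unitInterval) : ℝ) = 1 → ∀ u ∈ p, u ∈ X := by
      intro p hp u hu
      by_cases hpe : p = e
      · rw [hpe, he] at hu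
        rcases Sym2.mem_iff.1 hu with rfl | rfl
        · exact ha
        · exact hbX
      · rw [show w₁ p = w p from Function.update_of_ne hpe _ _] at hp; exact hINV p hp u hu
    rw [hXb, taB_rigid w₀ q y hsX hR0 hI0 g, taB_rigid w₁ q y hsX hR1 hI1 g, tab_rigid w₀ hq0 hyX hR0 hI0,
      tab_rigid w₁ hq0 hyX hR1 hI1]
    set B : Set (Sym2 V) := {p : Sym2 V | ∃ u ∈ p, u ∈ X} with hB
    have heB : e ∈ B := ⟨a, by rw [he]; exact Sym2.mem_mk_left _ _, ha⟩
    have hwB : ∀ p ∉ B, w₀ p = w₁ p := by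
      intro p hp
      have hpe : p ≠ e := fun h => hp (h ▸ heB)
      rw [show w₀ p = w p from Function.update_of_ne hpe _ _, show w₁ p = w p from Function.update_of_ne hpe _ _]
    simp only [wE_congr_off q hwB]
    have : rcPartitionFunctionW w₀ q ∅ *
          (wE w₁ q B (fun η => g (openEdgeCluster η s) * ind (openConn s y) η) -
            wE w₁ q B (fun η => g (openEdgeCluster η s)) * wE w₁ q B (ind (openConn s y))) *
          (rcPartitionFunctionW w₁ q ∅ * wE w₁ q B (ind (openConn s y : Set (BondConfig V))ᶜ)) -
        rcPartitionFunctionW w₁ q ∅ *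
          (wE w₁ q B (fun η => g (openEdgeCluster η s) * ind (openConn s y) η) -
            wE w₁ q B (fun η => g (openEdgeCluster η s)) * wE w₁ q B (ind (openConn s y))) *
          (rcPartitionFunctionW w₀ q ∅ * wE w₁ q B (ind (openConn s y : Set (BondConfig V))ᶜ)) = 0 := by ring
    rw [this]
  · -- EXIT pair
    have hXb' : a ∈ insert b X := Set.mem_insert_of_mem _ ha
    -- constant tilt for `B` and `b`
    have tiltB : taB w₁ q s y (insert b X) g = q⁻¹ * taB w₀ q s y (insert b X) g := by
      unfold taB
      rw [sum_update_one_eq_tilt w hq0 ha hbX hrig hINV (fun ω => ind (avoidEv s (insert b X)) ω * taC w₁ q s y (insert b X) g ω)]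
      congr 1
      refine Finset.sum_congr rfl fun ω _ => ?_
      have hav : ind (avoidEv s (insert b X)) (insert e ω) = ind (avoidEv s (insert b X)) ω := by
        have hiff := insert_mem_avoidEv_iff s a b (insert b X) hXb' ω
        rw [Set.insert_eq_of_mem (Set.mem_insert b X)] at hiff
        by_cases h : ω ∈ avoidEv s (insert b X)
        · rw [ind_of_mem h, ind_of_mem (hiff.2 h)]
        · rw [ind_of_not_mem h, ind_of_not_mem (fun h' => h (hiff.1 h'))]
      have hC : taC w₁ q s y (insert b X) g (insert e ω) = taC w₀ q s y (insert b X) g ω := by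
        have hcut : cut (insert b X) (insert e ω) = cut (insert b X) ω := by
          rw [he, cut_insert_edge a b (insert b X) hXb' ω, Set.insert_eq_of_mem (Set.mem_insert b X)]
        unfold taC
        rw [hcut, wE_congr_off q (update_eq_off_cut w₁ a b (insert b X) hXb' 0 ω),
          wE_congr_off q (update_eq_off_cut w₁ a b (insert b X) hXb' 0 ω),
          wE_congr_off q (update_eq_off_cut w₁ a b (insert b X) hXb' 0 ω)]
        have : Function.update w₁ s(a, b) 0 = w₀ := by
          rw [hw₁, hw₀, ← he, Function.update_idem]
        rw [this]
      show rcWeightW w₀ q ∅ ω * (ind (avoidEv s (insert b X)) (insert e ω) * taC w₁ q s y (insert b X) g (insert e ω)) =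
        rcWeightW w₀ q ∅ ω * (ind (avoidEv s (insert b X)) ω * taC w₀ q s y (insert b X) g ω)
      rw [hav, hC]
    have tiltb : tab w₁ q s y (insert b X) = q⁻¹ * tab w₀ q s y (insert b X) := by
      unfold tab
      rw [sum_update_one_eq_tilt w hq0 ha hbX hrig hINV (fun ω => ind (avoidEv y (insert s (insert b X))) ω)]
      congr 1
      refine Finset.sum_congr rfl fun ω _ => ?_
      have hXb'' : a ∈ insert s (insert b X) := Set.mem_insert_of_mem _ hXb'
      have hiff := insert_mem_avoidEv_iff y a b (insert s (insert b X)) hXb'' ω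
      rw [Set.insert_eq_of_mem (Set.mem_insert_of_mem s (Set.mem_insert b X))] at hiff
      show rcWeightW w₀ q ∅ ω * ind (avoidEv y (insert s (insert b X))) (insert e ω) =
        rcWeightW w₀ q ∅ ω * ind (avoidEv y (insert s (insert b X))) ω
      by_cases h : ω ∈ avoidEv y (insert s (insert b X))
      · rw [ind_of_mem h, ind_of_mem (hiff.2 h)]
      · rw [ind_of_not_mem h, ind_of_not_mem (fun h' => h (hiff.1 h'))]
    -- `b(w₀, X ∪ {b}) = b(w₀, X) − a(w₀; b; X)`
    have tabins : tab w₀ q s y (insert b X) = tab w₀ q s y X - taa w₀ q s y b X := by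
      unfold tab taa
      rw [← Finset.sum_sub_distrib]
      refine Finset.sum_congr rfl fun ω _ => ?_
      rw [avoidEv_insert_insert_eq s y b X, ind_inter_compl]
      have : ind (avoidEv y (insert s X) ∩ openConn y b) ω = ind (avoidEv y (insert s X)) ω * ind (openConn y b) ω := by
        by_cases h1 : ω ∈ avoidEv y (insert s X) <;> by_cases h2 : ω ∈ openConn y b
        · rw [ind_of_mem (Set.mem_inter h1 h2), ind_of_mem h1, ind_of_mem h2, mul_one]
        · rw [ind_of_not_mem (fun h => h2 h.2), ind_of_mem h1, ind_of_not_mem h2, mul_zero]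
        · rw [ind_of_not_mem (fun h => h1 h.1), ind_of_not_mem h1, zero_mul]
        · rw [ind_of_not_mem (fun h => h1 h.1), ind_of_not_mem h1, zero_mul]
      rw [this]; ring
    rw [tiltB, tiltb, tabins]
    rw [taB_rigid w₀ q y hsX hR0 hI0 g, tab_rigid w₀ hq0 hyX hR0 hI0, taa_rigid w₀ hq0 hyX hR0 hI0,
      taB_insert_rigid w₀ hq0 y hsX hbX hR0 hI0 g]
    -- world quantities of `H = G − B_X`
    set B : Set (Sym2 V) := {p : Sym2 V | ∃ u ∈ p, u ∈ X} with hB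
    set wH := delW w₀ B with hwH
    set c : ℝ := wE w₀ q B (fun η => g (openEdgeCluster η s) * ind (openConn s y) η) -
      wE w₀ q B (fun η => g (openEdgeCluster η s)) * wE w₀ q B (ind (openConn s y)) with hc
    set n : ℝ := wE w₀ q B (ind (openConn s y : Set (BondConfig V))ᶜ) with hn
    set nb : ℝ := wE w₀ q B (ind ((openConn s y : Set (BondConfig V))ᶜ ∩ openConn y b)) with hnb
    set β : ℝ := wE w₀ q B (fun η => ind (avoidEv s {b}) η * taC wH q s y {b} g η) with hβ
    set Z₀ : ℝ := rcPartitionFunctionW w₀ q ∅ with hZ₀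
    -- `P_v` in the world `H`, at `v = b`
    have hZH := rcPartitionFunctionW_pos wH hq0 ∅
    have hwHE : ∀ φ : Set (Sym2 V) → ℝ, wE wH q ∅ φ = wE w₀ q B φ := fun φ => wE_delW_empty w₀ q B φ
    have hBH : taB wH q s y {b} g = rcPartitionFunctionW wH q ∅ * β := by
      rw [hβ, ← hwHE]
      unfold taB wE
      rw [Finset.mul_sum]
      refine Finset.sum_congr rfl fun η _ => ?_
      rw [delW_empty]
      unfold rcMass
      field_simp
    have hPvH := hPv wH b
    rw [hBH, hwHE, hwHE, hwHE, hwHE, hwHE] at hPvH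
    -- `n > 0` (no weight-1 pair in the world weights)
    have hn0 : 0 < n := by
      rw [hn, ← hwHE]
      refine wE_compl_openConn_pos wH hq0 hsy fun p hp1 => ?_
      by_cases hpB : p ∈ B
      · rw [hwH, coe_delW, if_pos hpB] at hp1; exact zero_ne_one hp1
      · rw [hwH, coe_delW, if_neg hpB] at hp1
        apply hpB
        induction p using Sym2.ind with
        | h u' v' => exact ⟨u', Sym2.mem_mk_left _ _, hI0 _ hp1 u' (Sym2.mem_mk_left _ _)⟩
    have hβle : β * n ≤ (n - nb) * c := by
      have h1' : β ≤ (1 - nb / n) * c := le_of_mul_le_mul_left (by linarith [hPvH]) hZH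
      have h2' : (1 - nb / n) * c * n = (n - nb) * c := by field_simp
      nlinarith [mul_le_mul_of_nonneg_right h1' hn0.le]
    have hqinv : 0 < q⁻¹ := inv_pos.2 hq0
    have hZ0 : 0 < Z₀ := rcPartitionFunctionW_pos w₀ hq0 ∅
    have key : Z₀ * c * (q⁻¹ * (Z₀ * n - Z₀ * nb)) - q⁻¹ * (Z₀ * β) * (Z₀ * n) =
        q⁻¹ * Z₀ ^ 2 * ((n - nb) * c - β * n) := by ring
    rw [key]
    exact mul_nonneg (mul_nonneg hqinv.le (sq_nonneg _)) (by linarith)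

/-- **Lemma `Δ_N` for the random-cluster measure `φ_{𝐩,q}`, `q ≥ 1`, from prim-hp-7's Lemma `P_v` for `φ_{𝐩,q}`** (the FK analogue of
prove-5's `HullPort.deltaN_nonneg … (hPv)`; bschramm/FK-Q2.md §12.2–12.3): for every weight vector `w` with weight-`1` pairs inside the
avoided set `X`, every monotone test function `g`, and every pair `e = s(a,b)` touching `X` with `0 < w e < 1`,
`B(w[e↦1], X∪{b})·b(w[e↦0], X) ≤ B(w[e↦0], X)·b(w[e↦1], X∪{b})`.  The only hypothesis left is `hPv` = Lemma `P_v` (Gladkov's decision-tree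
Harris inequality for `φ_{𝐩,q}`, tree `FK.treeHarris_rc`, + vdBHK Thm 1.3 for `φ_{𝐩,q}`, tree) in its sum form for every weighted graph.
[cite: VandenbergHaggstromKahn2005, Thm. 2.1 (p. 9); §2.1 Lemma 2.3 (p. 10)] [cite: Gladkov2024, Thm. 3.2 (p. 4)] [cite: Grimmett2006, Thm. (3.1)(a), Thm. (3.8)(b)] -/
theorem deltaN_nonneg_of_Pv {q : ℝ} (hq : 1 ≤ q) (s y : V) (hsy : s ≠ y) (g : Set (Sym2 V) → ℝ) (hg : Monotone g)
    (hPv : ∀ (u : Sym2 V → unitInterval) (v' : V),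
      taB u q s y {v'} g ≤ rcPartitionFunctionW u q ∅ *
        ((1 - wE u q ∅ (ind ((openConn s y : Set (BondConfig V))ᶜ ∩ openConn y v')) /
              wE u q ∅ (ind (openConn s y : Set (BondConfig V))ᶜ)) *
          (wE u q ∅ (fun η => g (openEdgeCluster η s) * ind (openConn s y) η) -
            wE u q ∅ (fun η => g (openEdgeCluster η s)) * wE u q ∅ (ind (openConn s y)))))
    (w : Sym2 V → unitInterval) (X : Set V) (hINV : ∀ p : Sym2 V, ((w p : unitInterval) : ℝ) = 1 → ∀ u ∈ p, u ∈ X)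
    {a b : V} (ha : a ∈ X) (hab : a ≠ b) (h0 : 0 < ((w s(a, b) : unitInterval) : ℝ))
    (h1 : ((w s(a, b) : unitInterval) : ℝ) < 1) :
    0 ≤ taB (Function.update w s(a, b) 0) q s y X g * tab (Function.update w s(a, b) 1) q s y (insert b X) -
        taB (Function.update w s(a, b) 1) q s y (insert b X) g * tab (Function.update w s(a, b) 0) q s y X :=
  deltaN_nonneg_of_single hq s y hsy g hg
    (fun w X hI hsX hyX a b ha hab hbs hby h0 h1 hrig =>
      deltaN_single_of_Pv hq s y hsy g hPv w X hI hsX hyX a b ha hab hbs hby h0 h1 hrig)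
    w X hINV ha hab h0 h1

end SinglePair

end Summit.CriticalPhenomena.PercolationContinuityZ3.Theorems.FK

end
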